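import Literature.AlgebraicGeometry.Frobenioids.ModelFrobenioidBaseSection
import HarnessLib

/-!
# Frobenioids I, Theorem 5.2, proof (p. 101): the zero section OVER A SKELETON OF `D` is a
# base-Frobenius pair — the model Frobenioid is of pre-model type for an ARBITRARY base category `D`
# (abc-iut cell, layer L1, node `FrdI:Thm5.2(ii)`, the proof's observation F-D1a without `Skeletal D`)

Mochizuki, *The geometry of Frobenioids I: the general theory*, Kyushu J. Math. **62** (2008)
293–400, §5, proof of Theorem 5.2, kurims text p. 101 [cite: MochizukiFrdI2008, Thm. 5.2 p.101]:

> "Here, we observe that the objects `A = (A_D, α)` such that `α = 0` are Frobenius-trivial, and that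
> these objects, together with the morphisms `φ = (deg_Fr(φ), Base(φ), Div(φ), u_φ) : A → B` such that
> `Div(φ) = 0`, `u_φ = 1`, determine a base-Frobenius pair of `C`."

and p. 102 (proof of (iv)): "we may assume without loss of generality that `C` [hence `D`] is a
skeleton".

PROOF-ONLY companion of `ModelFrobenioidBaseSection.lean` (seat abc-iut-found / the cell's F-D1a node),
which proves the observation for `D` SKELETAL (`isBaseFrobeniusPair_zero`, `isOfPreModelType`, hypothesis
`hD : Skeletal D`; its docstring: "for a general `D` one restricts to a skeleton of `D`, which is not
carried out in this file").  This file carries it out: a base-section must be a skeleton (Def. 2.7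
(i)(a)), so over a general base one keeps only the objects `(A_D, 0)` whose base `A_D` is the CHOSEN
REPRESENTATIVE of its isomorphism class (`A_D = (fromSkeleton D).obj ⟦A_D⟧`, Mathlib's `Skeleton D`),
with the same morphisms `(1, f, 0, 1)` and the same Frobenius endomorphisms `(n, id, 0, 1)`:
* `skelPresection`, `skelFrobeniusSection` — the restricted zero section and its Frobenius-section;
* `isBaseFrobeniusPair_skel` — they form a base-Frobenius pair (Def. 2.7 (iii)) for `Φ` divisorial and
  `B` group-like, with NO hypothesis on `D`: `P → D` is faithful and full as before, essentially surjective
  because every `A_D` is isomorphic to its representative, and `P` is a skeleton because isomorphic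
  representatives are equal;
* `isOfPreModelType_of_isDivisorial` — **the model Frobenioid of `(Φ, B, Div_B)` is of pre-model type**
  (Def. 2.7 (iii)) over ANY connected totally epimorphic `D` — the pre-model half of "model type" in
  Thm. 5.2 (ii); consumers: [FrdII] Thm. 1.2 (i) "model type" (`PadicFrd.Datum.thm12_isOfPreModelType`,
  stated there for skeletal `D`), [FrdI] Prop. 5.5 (iii) for `C^rlf`.
No statement of the paper is strengthened; nothing is redefined from the statement files.
-/

noncomputable section

namespace Literature.AlgebraicGeometry.Frobenioids

namespace ModelFrobenioid

open CategoryTheory Opposite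

universe w v u

variable {D : Type u} [Category.{v} D] {Φ B : Dᵒᵖ ⥤ CommMonCat.{w}} {DivB : B ⟶ monoidGp Φ}

/-! ### Representatives of isomorphism classes of `D` -/

/-- `A ∈ Ob(D)` is the chosen representative of its isomorphism class: it is the image of its class
under Mathlib's `fromSkeleton D : Skeleton D ⥤ D` ("we may assume … that `C` is a skeleton", p. 102).
[cite: MochizukiFrdI2008, Thm. 5.2 p.102] -/
def IsSkeletonRep (A : D) : Prop := (fromSkeleton D).obj (toSkeleton A) = A

/-- The image of every object of the skeleton is a representative.
[cite: MochizukiFrdI2008, Thm. 5.2 p.102] -/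
theorem isSkeletonRep_obj (X : Skeleton D) : IsSkeletonRep ((fromSkeleton D).obj X) := by
  unfold IsSkeletonRep
  rw [toSkeleton_fromSkeleton_obj]

/-- Every object of `D` is isomorphic to a representative. [cite: MochizukiFrdI2008, Thm. 5.2 p.102] -/
theorem exists_isSkeletonRep_iso (A₀ : D) : ∃ A : D, IsSkeletonRep A ∧ Nonempty (A ≅ A₀) :=
  ⟨(fromSkeleton D).obj (toSkeleton A₀), isSkeletonRep_obj _, ⟨fromSkeletonToSkeletonIso A₀⟩⟩

/-- Isomorphic representatives are equal. [cite: MochizukiFrdI2008, Thm. 5.2 p.102] -/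
theorem IsSkeletonRep.eq_of_iso {A A' : D} (hA : IsSkeletonRep A) (hA' : IsSkeletonRep A')
    (e : A ≅ A') : A = A' :=
  calc A = (fromSkeleton D).obj (toSkeleton A) := hA.symm
    _ = (fromSkeleton D).obj (toSkeleton A') := by rw [congr_toSkeleton_of_iso e]
    _ = A' := hA'

/-! ### The zero section over the skeleton -/

variable (Φ B DivB) in
/-- The subcategory `P`: objects `(A_D, 0)` WITH `A_D` A REPRESENTATIVE of its isomorphism class,
morphisms the linear `(1, f, 0, 1)` between them (the zero section of `ModelFrobenioidBaseSection.lean`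
restricted to a skeleton of `D`). [cite: MochizukiFrdI2008, Thm. 5.2 p.101] -/
def skelPresection : Presection (ModelFrobenioid Φ B DivB) where
  obj X := (zeroPresection Φ B DivB).obj X ∧ IsSkeletonRep X.base
  hom {X Y} φ := (zeroPresection Φ B DivB).hom φ ∧ IsSkeletonRep X.base ∧ IsSkeletonRep Y.base
  obj_of_hom φ h :=
    ⟨⟨((zeroPresection Φ B DivB).obj_of_hom φ h.1).1, h.2.1⟩,
      ⟨((zeroPresection Φ B DivB).obj_of_hom φ h.1).2, h.2.2⟩⟩
  hom_id h := ⟨(zeroPresection Φ B DivB).hom_id h.1, h.2, h.2⟩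
  hom_comp φ ψ hφ hψ := ⟨(zeroPresection Φ B DivB).hom_comp φ ψ hφ.1 hψ.1, hφ.2.1, hψ.2.2⟩

variable (Φ B DivB) in
/-- The Frobenius-section `F : N_{≥1} → End(P ↪ C)`, `n ↦ ((n, id, 0, 1)_A)_A`, on the restricted zero
section. [cite: MochizukiFrdI2008, Thm. 5.2 p.101] -/
def skelFrobeniusSection : ℕ+ →* End (skelPresection Φ B DivB).ι where
  toFun n :=
    { app := fun A => zeroFrob ((skelPresection Φ B DivB).ι.obj A) A.2.1 n
      naturality := fun _ _ f => zeroFrob_naturality f.1 f.2.1 n }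
  map_one' := by
    apply NatTrans.ext
    funext A
    exact hom_ext rfl rfl rfl rfl
  map_mul' m n := by
    apply NatTrans.ext
    funext A
    refine hom_ext rfl (Category.comp_id _).symm ?_ ?_
    · show (1 : Φ.obj (op ((skelPresection Φ B DivB).ι.obj A).base)) = pull Φ (𝟙 _) 1 * 1 ^ (m : ℕ)
      rw [map_one, one_pow, mul_one]
    · show (1 : B.obj (op ((skelPresection Φ B DivB).ι.obj A).base)) = pull B (𝟙 _) 1 * 1 ^ (m : ℕ)
      rw [map_one, one_pow, mul_one]

/-! ### The restricted zero section is a base-Frobenius pair (no hypothesis on `D`) -/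

/-- `P ↪ C → D` is faithful. [cite: MochizukiFrdI2008, Thm. 5.2 p.101] -/
theorem skelPresection_toBase_faithful :
    ((skelPresection Φ B DivB).toBase (toElem Φ B DivB)).Faithful := by
  refine ⟨fun {X Y} {f g} h => ?_⟩
  have h' : baseMap f.1 = baseMap g.1 := h
  obtain ⟨⟨_, _, hd, hv, hu⟩, -⟩ := f.2
  obtain ⟨⟨_, _, hd', hv', hu'⟩, -⟩ := g.2
  exact Subtype.ext (hom_ext (hd.trans hd'.symm) h' (hv.trans hv'.symm) (hu.trans hu'.symm))

/-- `P ↪ C → D` is full: `f` lifts to `(1, f, 0, 1)`. [cite: MochizukiFrdI2008, Thm. 5.2 p.101] -/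
theorem skelPresection_toBase_full :
    ((skelPresection Φ B DivB).toBase (toElem Φ B DivB)).Full := by
  refine ⟨fun {X Y} d => ?_⟩
  let d₀ : X.1.base ⟶ Y.1.base := d
  have hX : X.1.cls = 1 := X.2.1
  have hY : Y.1.cls = 1 := Y.2.1
  refine ⟨⟨mkHom X.1 Y.1 1 d₀ 1 1 ?_, ⟨⟨hX, hY, rfl, rfl, rfl⟩, X.2.2, Y.2.2⟩⟩, rfl⟩
  rw [hX, hY, one_pow, map_one, map_one, map_one, mul_one]

/-- `P ↪ C → D` is essentially surjective: every `A_D` is isomorphic to the representative of its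
class, the base of an object `(·, 0)` of `P`. [cite: MochizukiFrdI2008, Thm. 5.2 p.101] -/
theorem skelPresection_toBase_essSurj :
    ((skelPresection Φ B DivB).toBase (toElem Φ B DivB)).EssSurj :=
  ⟨fun A₀ =>
    ⟨⟨zeroObj Φ B DivB ((fromSkeleton D).obj (toSkeleton A₀)), rfl, isSkeletonRep_obj _⟩,
      ⟨fromSkeletonToSkeletonIso A₀⟩⟩⟩

/-- The restricted zero section `P` is a skeleton: isomorphic objects of `P` have isomorphic, hence
EQUAL, representative bases and zero classes. [cite: MochizukiFrdI2008, Thm. 5.2 p.101] -/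
theorem skelPresection_isSkeleton : (skelPresection Φ B DivB).IsSkeleton := by
  rintro ⟨⟨a, α⟩, hA, ha⟩ ⟨⟨b, β⟩, hB, hb⟩ ⟨e⟩
  have hα : α = 1 := hA
  have hβ : β = 1 := hB
  have hab : a = b :=
    IsSkeletonRep.eq_of_iso ha hb (((skelPresection Φ B DivB).toBase (toElem Φ B DivB)).mapIso e)
  subst hab
  subst hα
  subst hβ
  rfl

/-- **Proof of Thm. 5.2, observation (p. 101), over an ARBITRARY base `D`**: the zero section over the
chosen skeleton of `D` and its Frobenius endomorphisms form a base-Frobenius pair of the model Frobenioid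
(Def. 2.7 (iii)), for `Φ` divisorial and `B` group-like. [cite: MochizukiFrdI2008, Thm. 5.2 p.101] -/
theorem isBaseFrobeniusPair_skel (hΦd : Objectwise (fun M _ => IsDivisorial M) Φ)
    (hBg : Objectwise (fun M _ => IsGroupLike M) B) :
    PreFrobenioid.IsBaseFrobeniusPair (toElem Φ B DivB) (skelPresection Φ B DivB)
      (skelFrobeniusSection Φ B DivB) where
  isBaseSection :=
    { hom_pullback := fun _ h => isPullbackMorphism_of hΦd hBg h.1.2.2.1 h.1.2.2.2.1
      isSkeleton := skelPresection_isSkeleton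
      isFrobeniusTrivial := fun X hX => isFrobeniusTrivial_of_cls_eq_one hBg X hX.1
      isEquivalence := by
        haveI := skelPresection_toBase_faithful (Φ := Φ) (B := B) (DivB := DivB)
        haveI := skelPresection_toBase_full (Φ := Φ) (B := B) (DivB := DivB)
        haveI := skelPresection_toBase_essSurj (Φ := Φ) (B := B) (DivB := DivB)
        exact {} }
  isFrobeniusSection :=
    { degFr_eq := fun _ _ => rfl
      isBaseIdentity := fun _ _ => rfl
      isFrobeniusType := fun _ A =>
        ⟨⟨isCoAngular hBg _, rfl⟩, show IsIso (𝟙 A.1.base) from inferInstance⟩ }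

/-- **Thm. 5.2 (ii), "model type", pre-model half, over an ARBITRARY base `D`**: the model Frobenioid of
`(Φ, B, Div_B)` with `Φ` divisorial and `B` group-like is of pre-model type (Def. 2.7 (iii)) — the
hypothesis `Skeletal D` of `ModelFrobenioid.isOfPreModelType` removed by restricting the zero section to a
skeleton of `D`. [cite: MochizukiFrdI2008, Thm. 5.2(ii) p.101] -/
theorem isOfPreModelType_of_isDivisorial (hΦd : Objectwise (fun M _ => IsDivisorial M) Φ)
    (hBg : Objectwise (fun M _ => IsGroupLike M) B) :
    PreFrobenioid.IsOfPreModelType (toElem Φ B DivB) :=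
  ⟨_, _, isBaseFrobeniusPair_skel hΦd hBg⟩

end ModelFrobenioid

end Literature.AlgebraicGeometry.Frobenioids

end
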